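import Mathlib
import HarnessLib

/-!
# The scalar first-order linear operator `f ↦ f' − c f` and its explicit right inverse

Analysis/ODE support file (everything proved, no definitions). For a continuous coefficient
`c : ℝ → ℝ` with a primitive `I` (`I' = c`) the integrating-factor formula

  `R F (x) = e^{I(x)} ∫_{x₁}^x e^{−I(y)} F(y) dy`

is a global right inverse of `A f = f' − c f`: `(R F)' = c · R F + F` (`hasDerivAt_integratingFactor`),
and it gains one derivative, `F ∈ Cⁿ, I ∈ Cⁿ⁺¹ ⇒ R F ∈ Cⁿ⁺¹` (`contDiff_integratingFactor`). Used with
`c = k ι`, `ι = 1/(x − x₀)` on a half-line (so that `A = ∂ − k/(x − x₀)` is the intertwining operator of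
the inverse-square potentials `(k−1)k/(x−x₀)²` and `k(k+1)/(x−x₀)²`) to produce the smooth pre-images
`D_ℓ⁻¹ h` of far-field data in the exact inverse-square channel estimate (route PhotonSphereChannels,
`FixedModeChannels`, stmt-FinalStateConjecture-10048). Folklore (Hartman, *ODE*, Ch. IV §1).
-/

noncomputable section

namespace Literature.Analysis.ODE

open MeasureTheory Set Filter Topology intervalIntegral

variable {c I F : ℝ → ℝ}

/-- **Integrating factor.** If `I' = c` everywhere and `F` is continuous, then
`x ↦ e^{I x} ∫_{x₁}^x e^{−I} F` has derivative `c x · (e^{I x} ∫_{x₁}^x e^{−I} F) + F x`: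
it solves `f' − c f = F`. [folklore] -/
theorem hasDerivAt_integratingFactor (hI : ∀ x, HasDerivAt I (c x) x) (hF : Continuous F)
    (x₁ x : ℝ) :
    HasDerivAt (fun x => Real.exp (I x) * ∫ y in x₁..x, Real.exp (-I y) * F y)
      (c x * (Real.exp (I x) * ∫ y in x₁..x, Real.exp (-I y) * F y) + F x) x := by
  have hIc : Continuous I := continuous_iff_continuousAt.2 fun x => (hI x).continuousAt
  have hg : Continuous fun y => Real.exp (-I y) * F y := (Real.continuous_exp.comp hIc.neg).mul hF
  have hP : HasDerivAt (fun x => ∫ y in x₁..x, Real.exp (-I y) * F y) (Real.exp (-I x) * F x) x :=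
    intervalIntegral.integral_hasDerivAt_right (hg.intervalIntegrable _ _)
      (hg.stronglyMeasurableAtFilter _ _) hg.continuousAt
  have hE : HasDerivAt (fun x => Real.exp (I x)) (Real.exp (I x) * c x) x := (hI x).exp
  have h := hE.mul hP
  refine h.congr_deriv ?_
  have hee : Real.exp (I x) * (Real.exp (-I x) * F x) = F x := by
    rw [← mul_assoc, ← Real.exp_add, add_neg_cancel, Real.exp_zero, one_mul]
  rw [hee]
  ring

/-- The right-inverse identity in `deriv` form: with `f = e^{I} ∫_{x₁}^· e^{−I} F`,
`deriv f x − c x · f x = F x`. [folklore] -/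
theorem deriv_integratingFactor_sub (hI : ∀ x, HasDerivAt I (c x) x) (hF : Continuous F)
    (x₁ x : ℝ) :
    deriv (fun x => Real.exp (I x) * ∫ y in x₁..x, Real.exp (-I y) * F y) x
      - c x * (Real.exp (I x) * ∫ y in x₁..x, Real.exp (-I y) * F y) = F x := by
  rw [(hasDerivAt_integratingFactor hI hF x₁ x).deriv]; ring

/-- A primitive of a `Cⁿ` function is `Cⁿ⁺¹` (interval-integral form). [folklore] -/
theorem contDiff_primitive_of_contDiff {g : ℝ → ℝ} {n : ℕ} (hg : ContDiff ℝ n g) (x₁ : ℝ) :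
    ContDiff ℝ (n + 1) (fun x => ∫ y in x₁..x, g y) := by
  have hgc : Continuous g := hg.continuous
  have hd : ∀ x, HasDerivAt (fun x => ∫ y in x₁..x, g y) (g x) x := fun x =>
    intervalIntegral.integral_hasDerivAt_right (hgc.intervalIntegrable _ _)
      (hgc.stronglyMeasurableAtFilter _ _) hgc.continuousAt
  rw [contDiff_succ_iff_deriv]
  refine ⟨fun x => (hd x).differentiableAt, fun h => absurd h (by simp), ?_⟩
  have : deriv (fun x => ∫ y in x₁..x, g y) = g := funext fun x => (hd x).deriv
  rw [this]
  exact hg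

/-- **The right inverse gains one derivative**: if `F ∈ Cⁿ` and `I ∈ Cⁿ⁺¹` then
`x ↦ e^{I x} ∫_{x₁}^x e^{−I} F ∈ Cⁿ⁺¹`. [folklore] -/
theorem contDiff_integratingFactor {n : ℕ} (hI : ContDiff ℝ (n + 1) I) (hF : ContDiff ℝ n F)
    (x₁ : ℝ) :
    ContDiff ℝ (n + 1) (fun x => Real.exp (I x) * ∫ y in x₁..x, Real.exp (-I y) * F y) := by
  have hIn : ContDiff ℝ n I := hI.of_le (by exact_mod_cast Nat.le_succ n)
  have hg : ContDiff ℝ n fun y => Real.exp (-I y) * F y := (Real.contDiff_exp.comp hIn.neg).mul hF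
  exact (Real.contDiff_exp.comp hI).mul (contDiff_primitive_of_contDiff hg x₁)

/-- **Iterated right inverses keep solving**: if `f = e^{I}∫ e^{−I} F` then for every `x`,
`HasDerivAt f (c x * f x + F x) x`; packaged existence statement for callers that only need SOME
`Cⁿ⁺¹` solution of `f' − c f = F` with `f(x₁) = 0`. [folklore] -/
theorem exists_contDiff_solution_deriv_sub_mul {n : ℕ} (hI : ContDiff ℝ (n + 1) I)
    (hI' : ∀ x, HasDerivAt I (c x) x) (hF : ContDiff ℝ n F) (x₁ : ℝ) :
    ∃ f : ℝ → ℝ, ContDiff ℝ (n + 1) f ∧ f x₁ = 0 ∧ ∀ x, HasDerivAt f (c x * f x + F x) x :=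
  ⟨fun x => Real.exp (I x) * ∫ y in x₁..x, Real.exp (-I y) * F y,
    contDiff_integratingFactor hI hF x₁, by simp,
    fun x => hasDerivAt_integratingFactor hI' hF.continuous x₁ x⟩

end Literature.Analysis.ODE
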